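import Mathlib
import HarnessLib

/-!
# The determinant bound `det(1 − B) ≥ (1 − θ)^{tr B / θ}` for `0 ≤ B ≤ θ < 1`
# (the "standard estimate for the determinant" of Adams–Buchholz–Kotecký–Müller, Lemma 7.7 (i))

In the multiscale analysis of gradient models the large-field weights are Gaussian-integrated by
`∫ e^{½(A(φ+ψ),φ+ψ)} μ_C(dψ) = det(1 − C^{1/2}AC^{1/2})^{−1/2} e^{…}` ([ABKM19] (7.8)); the
prefactor is controlled by the trace: "The estimate for the determinant is now standard. We denote
the eigenvalues of the operator … by `λ_i` … `λ_i ∈ [0, 1 − ρ/2]`. Concavity of the logarithm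
implies `log(1 − x) ≥ −(log(2/ρ)/(1 − ρ/2)) x` for `x ∈ [0, 1 − ρ/2]`. Using this we obtain the
bound `log det(1 − …) = Σ_i log(1 − λ_i) ≥ −(log(2/ρ)/(1−ρ/2)) Σ_i λ_i = −(…) Tr(…)`"
([ABKM19], proof of Lemma 7.7 (i)).  This file proves the statement for a real symmetric matrix
`B` with spectrum in `[0, θ]`, `0 < θ < 1`:

* `det_one_sub_eq_prod_one_sub_eigenvalues` — `det(1 − B) = ∏_i (1 − λ_i)` (characteristic
  polynomial at `1`);
* `eigenvalues_le_of_posSemidef_smul_one_sub` — `θ·1 − B ⪰ 0 ⇒ λ_i ≤ θ` (Rayleigh quotient);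
* `rpow_le_one_sub_of_le` — the chord inequality `(1 − θ)^{x/θ} ≤ 1 − x` on `[0, θ]` (concavity of
  `log`);
* **`rpow_trace_le_det_one_sub`** — `(1 − θ)^{tr B/θ} ≤ det(1 − B)`, and the form used for the
  weights, **`det_one_sub_rpow_neg_half_le`**: `det(1 − B)^{−1/2} ≤ (1 − θ)^{−tr B/(2θ)}`.

Everything is proved; no named fact.

## References
* S. Adams, S. Buchholz, R. Kotecký, S. Müller, arXiv:1910.13564, Lemma 7.7 (i) and its proof
  [AdamsBuchholzKoteckyMuller2019].
-/

noncomputable section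

open Matrix
open scoped Matrix

namespace Literature.Analysis.Matrix

variable {n : Type*} [Fintype n] [DecidableEq n]

/-- **`det(1 − B) = ∏_i (1 − λ_i)`** for a real symmetric `B` with eigenvalues `λ_i` (the
characteristic polynomial `∏_i (X − λ_i)` evaluated at `1`).
[cite: AdamsBuchholzKoteckyMuller2019, Lemma 7.7 (proof of (i): "log det(1 − …) = Σ_i log(1 − λ_i)")] -/
theorem det_one_sub_eq_prod_one_sub_eigenvalues {B : Matrix n n ℝ} (hB : B.IsHermitian) :
    (1 - B).det = ∏ i, (1 - hB.eigenvalues i) := by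
  have h := Matrix.eval_charpoly B 1
  rw [hB.charpoly_eq, Polynomial.eval_prod] at h
  simp only [Polynomial.eval_sub, Polynomial.eval_X, Polynomial.eval_C, RCLike.ofReal_real_eq_id,
    id_eq] at h
  rw [h]
  congr 1

/-- **Rayleigh bound**: if `θ·1 − B` is positive semidefinite then every eigenvalue of the real
symmetric matrix `B` is at most `θ`. [cite: AdamsBuchholzKoteckyMuller2019, Lemma 7.7 (proof of (i): "λ_i ∈ [0, 1 − ρ/2]")] -/
theorem eigenvalues_le_of_posSemidef_smul_one_sub {B : Matrix n n ℝ} (hB : B.IsHermitian) {θ : ℝ}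
    (hθ : (θ • (1 : Matrix n n ℝ) - B).PosSemidef) (i : n) :
    hB.eigenvalues i ≤ θ := by
  set v : n → ℝ := ⇑(hB.eigenvectorBasis i) with hv
  have hnorm : star v ⬝ᵥ v = 1 := by
    have h1 : ‖hB.eigenvectorBasis i‖ = 1 := hB.eigenvectorBasis.orthonormal.1 i
    have h2 : (@inner ℝ _ _ (hB.eigenvectorBasis i) (hB.eigenvectorBasis i)) = star v ⬝ᵥ v := by
      rw [EuclideanSpace.inner_eq_star_dotProduct]
      rfl
    rw [← h2, real_inner_self_eq_norm_sq, h1, one_pow]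
  have heig : hB.eigenvalues i = star v ⬝ᵥ B *ᵥ v := by
    rw [hB.eigenvalues_eq i]
    rfl
  have hpos : 0 ≤ star v ⬝ᵥ (θ • (1 : Matrix n n ℝ) - B) *ᵥ v := hθ.dotProduct_mulVec_nonneg v
  rw [Matrix.sub_mulVec, dotProduct_sub, Matrix.smul_mulVec, Matrix.one_mulVec, dotProduct_smul,
    hnorm, smul_eq_mul, mul_one, ← heig] at hpos
  linarith

/-- Eigenvalues of a positive semidefinite real matrix are non-negative (Mathlib, restated with the
Hermitian witness used here). [cite: AdamsBuchholzKoteckyMuller2019, Lemma 7.7 (proof of (i): "λ_i ∈ [0, 1 − ρ/2]")] -/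
theorem eigenvalues_nonneg_of_posSemidef {B : Matrix n n ℝ} (hB : B.IsHermitian)
    (hB0 : B.PosSemidef) (i : n) : 0 ≤ hB.eigenvalues i :=
  hB.posSemidef_iff_eigenvalues_nonneg.mp hB0 i

omit [Fintype n] [DecidableEq n] in
/-- **Chord inequality for the concave logarithm**: for `0 < θ < 1` and `0 ≤ x ≤ θ`,
`(1 − θ)^{x/θ} ≤ 1 − x` (i.e. `log(1 − x) ≥ (x/θ) log(1 − θ)`).
[cite: AdamsBuchholzKoteckyMuller2019, Lemma 7.7 (proof of (i): "Concavity of the logarithm implies log(1 − x) ≥ −(log(2/ρ)/(1−ρ/2)) x")] -/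
theorem rpow_le_one_sub_of_le {θ x : ℝ} (hθ0 : 0 < θ) (hθ1 : θ < 1) (hx0 : 0 ≤ x) (hxθ : x ≤ θ) :
    (1 - θ) ^ (x / θ) ≤ 1 - x := by
  -- concavity of `log` between the points `1` and `1 − θ` with weights `1 − x/θ`, `x/θ`
  have hconc := (strictConcaveOn_log_Ioi).concaveOn
  have ha : 0 ≤ 1 - x / θ := by
    rw [sub_nonneg, div_le_one hθ0]; exact hxθ
  have hb : 0 ≤ x / θ := div_nonneg hx0 hθ0.le
  have hab : 1 - x / θ + x / θ = 1 := by ring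
  have h1 : (1 : ℝ) ∈ Set.Ioi (0 : ℝ) := Set.mem_Ioi.2 one_pos
  have h2 : (1 - θ : ℝ) ∈ Set.Ioi (0 : ℝ) := Set.mem_Ioi.2 (by linarith)
  have key := hconc.2 h1 h2 ha hb hab
  -- the convex combination is `1 − x`
  have hcomb : (1 - x / θ) • (1 : ℝ) + (x / θ) • (1 - θ) = 1 - x := by
    simp only [smul_eq_mul]
    field_simp
    ring
  rw [hcomb, Real.log_one, smul_eq_mul, mul_zero, zero_add, smul_eq_mul] at key
  -- `x/θ · log(1−θ) ≤ log(1−x)` ⇒ `(1−θ)^{x/θ} ≤ 1−x`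
  have h1x : 0 < 1 - x := by linarith
  rw [← Real.log_le_log_iff (Real.rpow_pos_of_pos (by linarith) _) h1x, Real.log_rpow (by linarith)]
  linarith [key]

/-- **`(1 − θ)^{tr B/θ} ≤ det(1 − B)`** for a real symmetric `B` with `0 ⪯ B ⪯ θ·1`, `0 < θ < 1`
("the standard estimate for the determinant": `log det(1−B) = Σ log(1−λ_i) ≥ (log(1−θ)/θ) Σ λ_i`).
[cite: AdamsBuchholzKoteckyMuller2019, Lemma 7.7 (i) (proof, display (7.62))] -/
theorem rpow_trace_le_det_one_sub {B : Matrix n n ℝ} (hB0 : B.PosSemidef) {θ : ℝ} (hθ0 : 0 < θ)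
    (hθ1 : θ < 1) (hθ : (θ • (1 : Matrix n n ℝ) - B).PosSemidef) :
    (1 - θ) ^ (B.trace / θ) ≤ (1 - B).det := by
  have hB : B.IsHermitian := hB0.1
  rw [det_one_sub_eq_prod_one_sub_eigenvalues hB, hB.trace_eq_sum_eigenvalues]
  simp only [RCLike.ofReal_real_eq_id, id_eq]
  rw [Finset.sum_div, Real.rpow_sum_of_pos (by linarith)]
  refine Finset.prod_le_prod (fun i _ => (Real.rpow_pos_of_pos (by linarith) _).le) fun i _ => ?_
  exact rpow_le_one_sub_of_le hθ0 hθ1 (eigenvalues_nonneg_of_posSemidef hB hB0 i)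
    (eigenvalues_le_of_posSemidef_smul_one_sub hB hθ i)

/-- Positivity of `det(1 − B)` under the same hypotheses.
[cite: AdamsBuchholzKoteckyMuller2019, Lemma 7.7 (i) (proof: "the determinant in (7.59) is non-vanishing")] -/
theorem det_one_sub_pos {B : Matrix n n ℝ} (hB0 : B.PosSemidef) {θ : ℝ} (hθ0 : 0 < θ)
    (hθ1 : θ < 1) (hθ : (θ • (1 : Matrix n n ℝ) - B).PosSemidef) : 0 < (1 - B).det :=
  lt_of_lt_of_le (Real.rpow_pos_of_pos (by linarith) _) (rpow_trace_le_det_one_sub hB0 hθ0 hθ1 hθ)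

/-- **The form used for the weights**: `det(1 − B)^{−1/2} ≤ (1 − θ)^{−tr B/(2θ)}` for a real
symmetric `B` with `0 ⪯ B ⪯ θ·1`, `0 < θ < 1` ([ABKM19] (7.59): the Gaussian prefactor is at most
exponential in the trace, hence in the number of blocks).
[cite: AdamsBuchholzKoteckyMuller2019, Lemma 7.7 (i) (display (7.59))] -/
theorem det_one_sub_rpow_neg_half_le {B : Matrix n n ℝ} (hB0 : B.PosSemidef) {θ : ℝ} (hθ0 : 0 < θ)
    (hθ1 : θ < 1) (hθ : (θ • (1 : Matrix n n ℝ) - B).PosSemidef) :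
    (1 - B).det ^ (-(1/2 : ℝ)) ≤ (1 - θ) ^ (-(B.trace / (2 * θ))) := by
  have h1θ : 0 < 1 - θ := by linarith
  have hlow := rpow_trace_le_det_one_sub hB0 hθ0 hθ1 hθ
  have hpos : 0 < (1 - θ) ^ (B.trace / θ) := Real.rpow_pos_of_pos h1θ _
  -- `t ↦ t^{-1/2}` is antitone on `(0, ∞)`
  have hanti : (1 - B).det ^ (-(1/2 : ℝ)) ≤ ((1 - θ) ^ (B.trace / θ)) ^ (-(1/2 : ℝ)) :=
    Real.rpow_le_rpow_of_nonpos hpos hlow (by norm_num)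
  refine hanti.trans (le_of_eq ?_)
  rw [← Real.rpow_mul h1θ.le]
  congr 1
  ring

end Literature.Analysis.Matrix

end
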